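import Literature.AlgebraicGeometry.Modules.VanishingLocusBaseChange
import Literature.AlgebraicGeometry.Modules.PushforwardBaseChangeHom
import Literature.AlgebraicGeometry.Morphisms.FlatClosedSubschemeEqOfFibres
import HarnessLib

/-!
# The equations of a subbundle: the transpose `π^* K ⟶ L` of `K ⟶ π_* L`, its vanishing locus, and base change

Topic `Literature/AlgebraicGeometry/Modules`, namespace `Literature.AlgebraicGeometry.Modules`.  THEOREMS ONLY (no definition, no
instance, no notation, no named fact, no `sorry`).  Cell `hodgecm-mathlib` (D-0151), F-DAG leaf F-5 (5d) (director s232; B-plan1 (g17)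
09:09:40Z), FILE 2 of the (II′) MONO wrapper «`Z = V(u_{K_Z(d)})`» (author B-p20 (g12), census `CENSUS-5dII-Mono` §0 (U)); second
consumer (III-Gr) (H2) «the universal family `ZOf H (j^* 𝒦)` pulls back» (B-p03 (g18)).  Count-neutral Mathlib-side capital: HC_CM is
proved only modulo the 7 printed citations until rung 0 closes — nothing here is about HC.

THE PRINT.  [Mumford1966CurvesSurface] Lecture 15 (IV.) p. 107: a `T`-point of the Grassmannian is a subbundle `K ⊆ 𝒪_T ⊗ H⁰(𝐏, 𝒪(m₀))`, and
«define `𝓘` to be the image of `p^*(K)(-m₀)` in `o_{F × S}`: a sheaf of ideals» — the closed subscheme CUT OUT BY THE EQUATIONS of `K`,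
i.e. the vanishing locus ([Fulton1998] B.3.4) of the adjoint `u_K : π^* K ⟶ 𝒪(m₀)` of `K ⟶ 𝒪_T ⊗ H⁰(𝒪(m₀)) → π_* 𝒪(m₀)`.  This file is the
generic module-theoretic core: for ANY `π : X ⟶ T`, `𝒪_T`-module `K`, `𝒪_X`-module `L` and `v : K ⟶ π_* L`, the TRANSPOSE
`v♭ := ((pullbackPushforwardAdjunction π).homEquiv K L).symm v : π^* K ⟶ L` across Mathlib's adjunction `π^* ⊣ π_*`
([Hartshorne1977] II §5 p. 110):

* §1 `transpose_app_unitSection` — `v♭(η_π k) = v(k)` on pulled-back sections (a triangle identity, ★ `counit_app_unitSection`);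
  `homEquiv_eq_zero_iff`, `transpose_eq_zero_iff`;
* §2 **`vanishingIdeal_transpose_le_ker_iff`** — for `i : Z ⟶ X`: `Z ⊆ V(v♭)` (i.e. `vanishingIdeal v♭ ≤ ker i^♯`) iff
  `v ≫ π_*(η_i) = 0 : K ⟶ π_* i_* i^* L` — «`Z` lies in the subscheme cut out by the equations iff the equations restrict to `0` on `Z`»
  (★ `vanishingIdeal_le_ker_iff` + two transpositions, no charts);
* §3 **`transpose_baseChange`** — for a commutative square `pr ≫ π = π' ≫ h` the transpose of the base-changed datum
  `h^* v ≫ β : h^* K ⟶ π'_* pr^* L` (★ `pushforwardBaseChangeHom`, [Hartshorne1977] III 9.3.1) is `pr^*(v♭)` preceded by the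
  pseudofunctor isomorphism `π'^* h^* K ≅ pr^* π^* K` (★ `pushforwardBaseChangeHom_counit`); `vanishingIdeal_iso_comp` (the vanishing locus
  does not see an isomorphism on the source) and **`comap_vanishingIdeal_transpose`** — `V(v♭) ×_X X' = V((h^* v ≫ β)♭)` as ideal sheaves
  (★ FILE 1 `comap_vanishingIdeal`), also for an isomorphic source `e : K' ≅ h^* K` (`comap_vanishingIdeal_transpose_of_iso`).

## References
* [Mumford1966CurvesSurface] D. Mumford, *Lectures on Curves on an Algebraic Surface* (1966), Lecture 15 «The Hilbert scheme», step (IV.) (p. 107).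
* [Fulton1998] W. Fulton, *Intersection Theory*, 2nd ed. (1998), App. B.3.4 (PDF p. 410).
* [Hartshorne1977] R. Hartshorne, *Algebraic Geometry* (1977), II §5 p. 110 (`f^* ⊣ f_*`), III Prop. 9.3 (Remark 9.3.1).
* [GortzWedhorn2020] U. Görtz, T. Wedhorn, *Algebraic Geometry I*, 2nd ed. (2020), Prop. 4.20 (closed subschemes and base change).
-/

noncomputable section

-- `TopCat.Presheaf`/`Scheme.Modules` are not reducible (as in Mathlib's `AlgebraicGeometry/Modules`).
set_option backward.isDefEq.respectTransparency false

universe u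

open CategoryTheory CategoryTheory.Limits AlgebraicGeometry TopologicalSpace Opposite

namespace Literature.AlgebraicGeometry.Modules

open Literature.AlgebraicGeometry.Motives Literature.AlgebraicGeometry.Morphisms

/-! ## §1 The transpose on pulled-back sections; transposes of zero -/

section Transpose

variable {X T : Scheme.{u}} (π : X ⟶ T) {K : T.Modules} {L : X.Modules}

/-- **`v♭(η_π(k)) = v(k)`**: the transpose `v♭ = π^* v ≫ ε_L : π^* K ⟶ L` of `v : K ⟶ π_* L` sends the pulled-back section `η_π(k)`,
`k ∈ Γ(K, V)`, to `v(k) ∈ Γ(π_* L, V) = Γ(L, π⁻¹V)` (★ `pullback_map_app_unitSection`, ★ `counit_app_unitSection`).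
[cite: Hartshorne1977, II §5 p. 110] -/
theorem transpose_app_unitSection (v : K ⟶ (Scheme.Modules.pushforward π).obj L) (V : T.Opens) (k : Γ(K, V)) :
    (((Scheme.Modules.pullbackPushforwardAdjunction π).homEquiv K L).symm v).app (π ⁻¹ᵁ V) (unitSection π K V k) =
      (show Γ(L, π ⁻¹ᵁ V) from v.app V k) := by
  rw [Adjunction.homEquiv_counit, Scheme.Modules.Hom.comp_app, CategoryTheory.comp_apply, pullback_map_app_unitSection]
  exact counit_app_unitSection π L V (v.app V k)

/-- `f♯ = 0 ↔ f = 0` for `f : π^* K ⟶ L` (`f♯ = η_K ≫ π_* f`, and `π_*`, `π^*` are additive). [cite: Hartshorne1977, II §5 p. 110] -/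
theorem homEquiv_eq_zero_iff (f : (Scheme.Modules.pullback π).obj K ⟶ L) :
    (Scheme.Modules.pullbackPushforwardAdjunction π).homEquiv K L f = 0 ↔ f = 0 := by
  constructor
  · intro h
    have h' := congrArg ((Scheme.Modules.pullbackPushforwardAdjunction π).homEquiv K L).symm h
    rw [Equiv.symm_apply_apply, Adjunction.homEquiv_counit, Functor.map_zero, zero_comp] at h'
    exact h'
  · rintro rfl
    rw [Adjunction.homEquiv_unit, Functor.map_zero, comp_zero]

/-- `v♭ = 0 ↔ v = 0` for `v : K ⟶ π_* L`. [cite: Hartshorne1977, II §5 p. 110] -/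
theorem transpose_eq_zero_iff (v : K ⟶ (Scheme.Modules.pushforward π).obj L) :
    ((Scheme.Modules.pullbackPushforwardAdjunction π).homEquiv K L).symm v = 0 ↔ v = 0 := by
  rw [← homEquiv_eq_zero_iff π (((Scheme.Modules.pullbackPushforwardAdjunction π).homEquiv K L).symm v),
    Equiv.apply_symm_apply]

end Transpose

/-! ## §2 `Z ⊆ V(v♭)` iff the equations restrict to zero on `Z` -/

section LeKer

variable {X T Z : Scheme.{u}} (π : X ⟶ T) (i : Z ⟶ X) {K : T.Modules} {L : X.Modules}
  (v : K ⟶ (Scheme.Modules.pushforward π).obj L)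

/-- **`i^*(v♭) = 0 ↔ v ≫ π_*(η_i) = 0`**: the transpose of `i^*(v♭) : i^* π^* K ⟶ i^* L` across `i^* ⊣ i_*` is `v♭ ≫ η_i(L)`
(naturality of the unit), whose transpose across `π^* ⊣ π_*` is `v ≫ π_*(η_i(L)) : K ⟶ π_* i_* i^* L`
(Mathlib `Adjunction.homEquiv_naturality_right`). [cite: Hartshorne1977, II §5 p. 110] -/
theorem pullback_map_transpose_eq_zero_iff :
    (Scheme.Modules.pullback i).map (((Scheme.Modules.pullbackPushforwardAdjunction π).homEquiv K L).symm v) = 0 ↔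
      v ≫ (Scheme.Modules.pushforward π).map ((Scheme.Modules.pullbackPushforwardAdjunction i).unit.app L) = 0 := by
  have e₁ : (Scheme.Modules.pullbackPushforwardAdjunction i).homEquiv _ _
      ((Scheme.Modules.pullback i).map (((Scheme.Modules.pullbackPushforwardAdjunction π).homEquiv K L).symm v)) =
      ((Scheme.Modules.pullbackPushforwardAdjunction π).homEquiv K L).symm v ≫
        (Scheme.Modules.pullbackPushforwardAdjunction i).unit.app L := by
    rw [Adjunction.homEquiv_unit, Adjunction.unit_naturality]
  have e₂ : (Scheme.Modules.pullbackPushforwardAdjunction π).homEquiv K _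
      (((Scheme.Modules.pullbackPushforwardAdjunction π).homEquiv K L).symm v ≫
        (Scheme.Modules.pullbackPushforwardAdjunction i).unit.app L) =
      v ≫ (Scheme.Modules.pushforward π).map ((Scheme.Modules.pullbackPushforwardAdjunction i).unit.app L) := by
    rw [Adjunction.homEquiv_naturality_right, Equiv.apply_symm_apply]
  rw [← homEquiv_eq_zero_iff i ((Scheme.Modules.pullback i).map _), e₁, ← homEquiv_eq_zero_iff π (_ ≫ _), e₂]

/-- **`Z ⊆ V(v♭)` iff the equations restrict to zero on `Z`**: for `K` affine-localizing (quasi-coherent), `L` finite locally free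
and `i : Z ⟶ X`, `vanishingIdeal v♭ ≤ ker i^♯ ↔ v ≫ π_*(η_i(L)) = 0` (★ `vanishingIdeal_le_ker_iff` and
`pullback_map_transpose_eq_zero_iff`).  For a closed immersion `i` and `v = kι ≫ φ` (`kι : K ⟶ 𝒪_T^{(J)}` a subbundle, `φ(ε_j)` given
global sections `s_j` of `L`) the right-hand side reads «`Σ k_j · s_j|_Z = 0` for all sections `k` of `K`» ([Mumford1966CurvesSurface] Lect. 15 (V.)).
[cite: Fulton1998, B.3.4 (PDF p. 410)] [cite: Mumford1966CurvesSurface, Lecture 15 (IV.)–(V.) (pp. 107–108)] [cite: Hartshorne1977, II §5 p. 110] -/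
theorem vanishingIdeal_transpose_le_ker_iff (hK : IsAffineLocalizing K) (hL : IsFiniteLocallyFree L) :
    vanishingIdeal (((Scheme.Modules.pullbackPushforwardAdjunction π).homEquiv K L).symm v) ≤ i.ker ↔
      v ≫ (Scheme.Modules.pushforward π).map ((Scheme.Modules.pullbackPushforwardAdjunction i).unit.app L) = 0 := by
  rw [vanishingIdeal_le_ker_iff _ i (frameSystemOfIsFiniteLocallyFree hL) (hK.pullback π)
      (isAffineLocalizing_dual_of_isFiniteLocallyFree hL),
    pullback_map_transpose_eq_zero_iff]

end LeKer

/-! ## §3 Base change of the transpose and of its vanishing locus -/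

section BaseChange

variable {X T X' T' : Scheme.{u}} {π : X ⟶ T} {pr : X' ⟶ X} {π' : X' ⟶ T'} {h : T' ⟶ T} (w : pr ≫ π = π' ≫ h)
  {K : T.Modules} {L : X.Modules} (v : K ⟶ (Scheme.Modules.pushforward π).obj L)

/-- **The transpose commutes with base change**: for a commutative square `pr ≫ π = π' ≫ h`, the transpose across `π'^* ⊣ π'_*` of the
base-changed datum `h^* v ≫ β_w(L) : h^* K ⟶ π'_* pr^* L` (★ `pushforwardBaseChangeHom`) is `pr^*(v♭)` preceded by the canonical
`π'^* h^* K ≅ (π' ≫ h)^* K = (pr ≫ π)^* K ≅ pr^* π^* K` (Mathlib `pullbackComp`, `pullbackCongr`) — since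
`π'^*(β_w) ≫ ε' = pushforwardBaseChangeCounit` (★ `pushforwardBaseChangeHom_counit`) is that isomorphism followed by `pr^*(ε)`.
[cite: Hartshorne1977, III Prop. 9.3 (Remark 9.3.1)] [cite: Hartshorne1977, II §5 p. 110] -/
theorem transpose_baseChange :
    ((Scheme.Modules.pullbackPushforwardAdjunction π').homEquiv _ _).symm
        ((Scheme.Modules.pullback h).map v ≫ pushforwardBaseChangeHom w L) =
      ((Scheme.Modules.pullbackComp π' h).hom.app K ≫ (Scheme.Modules.pullbackCongr w.symm).hom.app K ≫
          (Scheme.Modules.pullbackComp pr π).inv.app K) ≫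
        (Scheme.Modules.pullback pr).map (((Scheme.Modules.pullbackPushforwardAdjunction π).homEquiv K L).symm v) := by
  rw [Adjunction.homEquiv_naturality_left_symm, pushforwardBaseChangeHom, Equiv.symm_apply_apply, pushforwardBaseChangeCounit,
    Adjunction.homEquiv_counit]
  have h1 := (Scheme.Modules.pullbackComp π' h).hom.naturality v
  have h2 := (Scheme.Modules.pullbackCongr w.symm).hom.naturality v
  have h3 := (Scheme.Modules.pullbackComp pr π).inv.naturality v
  simp only [Functor.comp_map] at h1 h2 h3
  simp only [Category.assoc, Functor.map_comp]
  erw [reassoc_of% h1, reassoc_of% h2, reassoc_of% h3]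

/-- **The vanishing locus does not see an isomorphism on the source**: `V(e ≫ u) = V(u)` for an isomorphism `e : 𝓔' ≅ 𝓔` (both cut out
«`g^* u = 0`», since `g^* e` is an isomorphism; ★ `idealSheafData_eq_of_forall_le_ker_iff`). [cite: Fulton1998, B.3.4 (PDF p. 410)] -/
theorem vanishingIdeal_iso_comp {Y : Scheme.{u}} {E E' V : Y.Modules} (e : E' ≅ E) (u : E ⟶ V) (hE : IsAffineLocalizing E)
    (hE' : IsAffineLocalizing E') (hV : IsFiniteLocallyFree V) :
    vanishingIdeal (e.hom ≫ u) = vanishingIdeal u := by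
  apply idealSheafData_eq_of_forall_le_ker_iff
  intro T'' b
  rw [vanishingIdeal_le_ker_iff (e.hom ≫ u) b (frameSystemOfIsFiniteLocallyFree hV) hE'
      (isAffineLocalizing_dual_of_isFiniteLocallyFree hV),
    vanishingIdeal_le_ker_iff u b (frameSystemOfIsFiniteLocallyFree hV) hE (isAffineLocalizing_dual_of_isFiniteLocallyFree hV),
    Functor.map_comp]
  exact ⟨fun h0 => (cancel_epi ((Scheme.Modules.pullback b).map e.hom)).mp (by rw [h0, comp_zero]),
    fun h0 => by rw [h0, comp_zero]⟩

/-- **THE VANISHING LOCUS OF THE EQUATIONS COMMUTES WITH BASE CHANGE**: for `K` affine-localizing, `L` finite locally free and a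
commutative square `pr ≫ π = π' ≫ h`, the pull-back along `pr : X' ⟶ X` of the ideal sheaf `V(v♭)` (Mathlib `IdealSheafData.comap` —
the ideal of `X' ×_X V(v♭) ↪ X'`) is the vanishing ideal of the transpose of the base-changed datum `h^* v ≫ β_w(L)`:
`V(v♭) ×_X X' = V((h^* v ≫ β)♭)` ([Mumford1966CurvesSurface] Lect. 15 (IV.): «`Z_K` pulls back to `Z_{h^* K}`»; §3 `transpose_baseChange`, ★ FILE 1
`comap_vanishingIdeal`, `vanishingIdeal_iso_comp`). [cite: GortzWedhorn2020, Prop. 4.20] [cite: Mumford1966CurvesSurface, Lecture 15 (IV.)–(V.) (pp. 107–108)]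
[cite: Hartshorne1977, III Prop. 9.3 (Remark 9.3.1)] -/
theorem comap_vanishingIdeal_transpose (hK : IsAffineLocalizing K) (hL : IsFiniteLocallyFree L) :
    (vanishingIdeal (((Scheme.Modules.pullbackPushforwardAdjunction π).homEquiv K L).symm v)).comap pr =
      vanishingIdeal (((Scheme.Modules.pullbackPushforwardAdjunction π').homEquiv _ _).symm
        ((Scheme.Modules.pullback h).map v ≫ pushforwardBaseChangeHom w L)) := by
  rw [transpose_baseChange w v, comap_vanishingIdeal pr _ (hK.pullback π) hL]
  let e : (Scheme.Modules.pullback π').obj ((Scheme.Modules.pullback h).obj K) ≅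
      (Scheme.Modules.pullback pr).obj ((Scheme.Modules.pullback π).obj K) :=
    (Scheme.Modules.pullbackComp π' h).app K ≪≫ (Scheme.Modules.pullbackCongr w.symm).app K ≪≫
      ((Scheme.Modules.pullbackComp pr π).app K).symm
  have he : e.hom = (Scheme.Modules.pullbackComp π' h).hom.app K ≫ (Scheme.Modules.pullbackCongr w.symm).hom.app K ≫
      (Scheme.Modules.pullbackComp pr π).inv.app K := rfl
  rw [← he]
  exact (vanishingIdeal_iso_comp e _ ((hK.pullback π).pullback pr) ((hK.pullback h).pullback π') (hL.pullback pr)).symm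

/-- The same with an ISOMORPHIC source `e : K' ≅ h^* K` (e.g. `h^* 𝒪_T^{(J)} ≅ 𝒪_{T'}^{(J)}`, or the kernel of the base-changed
presentation): `V(v♭) ×_X X' = V((e ≫ h^* v ≫ β)♭)`. [cite: GortzWedhorn2020, Prop. 4.20] [cite: Mumford1966CurvesSurface, Lecture 15 (IV.)–(V.) (pp. 107–108)] -/
theorem comap_vanishingIdeal_transpose_of_iso (hK : IsAffineLocalizing K) (hL : IsFiniteLocallyFree L) {K' : T'.Modules}
    (hK' : IsAffineLocalizing K') (e : K' ≅ (Scheme.Modules.pullback h).obj K) :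
    (vanishingIdeal (((Scheme.Modules.pullbackPushforwardAdjunction π).homEquiv K L).symm v)).comap pr =
      vanishingIdeal (((Scheme.Modules.pullbackPushforwardAdjunction π').homEquiv _ _).symm
        (e.hom ≫ (Scheme.Modules.pullback h).map v ≫ pushforwardBaseChangeHom w L)) := by
  have hr : ((Scheme.Modules.pullbackPushforwardAdjunction π').homEquiv _ _).symm
      (e.hom ≫ (Scheme.Modules.pullback h).map v ≫ pushforwardBaseChangeHom w L) =
      (Scheme.Modules.pullback π').map e.hom ≫ ((Scheme.Modules.pullbackPushforwardAdjunction π').homEquiv _ _).symm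
        ((Scheme.Modules.pullback h).map v ≫ pushforwardBaseChangeHom w L) :=
    Adjunction.homEquiv_naturality_left_symm _ _ _
  rw [hr, comap_vanishingIdeal_transpose w v hK hL]
  exact (vanishingIdeal_iso_comp ((Scheme.Modules.pullback π').mapIso e) _ ((hK.pullback h).pullback π') (hK'.pullback π')
    (hL.pullback pr)).symm

end BaseChange

/-! ## §4 (ed. 2) A FLAT closed subscheme is cut out by the equations as soon as its fibres are

B-p21 (g18)'s ★ `Morphisms/FlatClosedSubschemeEqOfFibres` («a flat closed subscheme is determined by its fibres», Mumford Lect. 15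
(VII.) Lemma ∕ Nakayama) assembled with §2 (`Z ⊆ V(v♭)` from `v ≫ π_*η_i = 0`) and §3 (base change of `V(v♭)`): this is the RELATIVE
form of [Mumford1966CurvesSurface] Lecture 15 (V.) «`𝓘` is the image of `p^*(K)(-m₀)`», the pointwise content being ★
`Morphisms/ProjectiveSubschemeCutOutByDegreeEquations`. -/

section Flat

variable {X T Z : Scheme.{u}} (π : X ⟶ T) (i : Z ⟶ X) [IsClosedImmersion i] {K : T.Modules} {L : X.Modules}
  (v : K ⟶ (Scheme.Modules.pushforward π).obj L)

/-- For a closed immersion `i`, `V(ker i^♯) ⟶ X ⟶ T` is `(i.toImage)⁻¹ ≫ i ≫ π` (Mathlib `Scheme.Hom.toImage_imageι`), hence flat when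
`i ≫ π` is. [cite: Hartshorne1977, III Prop. 9.2 (p. 254)] -/
theorem flat_ker_subschemeι_comp [Flat (i ≫ π)] : Flat (i.ker.subschemeι ≫ π) := by
  have h : i.ker.subschemeι ≫ π = inv i.toImage ≫ (i ≫ π) := by
    rw [IsIso.eq_inv_comp, ← Category.assoc]
    change (i.toImage ≫ i.imageι) ≫ π = i ≫ π
    rw [Scheme.Hom.toImage_imageι]
  rw [h]
  infer_instance

/-- **A FLAT closed subscheme is cut out by the equations iff its fibres are** (field-point form): let `X → T` with `X` locally
Noetherian, `i : Z ⟶ X` a closed immersion with `Z → T` flat, `K` affine-localizing, `L` finite locally free and `v : K ⟶ π_* L` with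
`v ≫ π_*(η_i) = 0` (the equations vanish on `Z`).  If for every `t ∈ T` there are a field point `x : Spec K' ⟶ T` at `t` (ANY field
`K' ⊇ κ(t)`) and a cartesian square `X_{K'}` on which the ideal of `Z_{K'}` lies in the vanishing ideal of the transposed base-changed datum
`(x^* v ≫ β)♭` («the fibre is cut out by the equations»), then `𝓘_Z = V(v♭)` as ideal sheaves on `X` (§2, §3 and ★
`IdealSheafData.eq_of_le_of_flat_of_fieldPoint`). [cite: Mumford1966CurvesSurface, Lecture 15 (IV.)–(V.) (pp. 107–108)]
[cite: GortzWedhorn2020, Prop. 4.20] -/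
theorem ker_eq_vanishingIdeal_transpose_of_flat_of_fieldPoint [IsLocallyNoetherian X] [Flat (i ≫ π)]
    (hK : IsAffineLocalizing K) (hL : IsFiniteLocallyFree L)
    (hZ : v ≫ (Scheme.Modules.pushforward π).map ((Scheme.Modules.pullbackPushforwardAdjunction i).unit.app L) = 0)
    (hcut : ∀ t : T, ∃ (K' : Type u) (_ : Field K') (x : Spec (.of K') ⟶ T),
      x.base (IsLocalRing.closedPoint K') = t ∧ ∃ (XK : Scheme.{u}) (kP : XK ⟶ X) (fK : XK ⟶ Spec (.of K'))
        (H : IsPullback kP fK π x), i.ker.comap kP ≤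
          vanishingIdeal (((Scheme.Modules.pullbackPushforwardAdjunction fK).homEquiv _ _).symm
            ((Scheme.Modules.pullback x).map v ≫ pushforwardBaseChangeHom H.w L))) :
    i.ker = vanishingIdeal (((Scheme.Modules.pullbackPushforwardAdjunction π).homEquiv K L).symm v) := by
  haveI := flat_ker_subschemeι_comp π i
  symm
  refine IdealSheafData.eq_of_le_of_flat_of_fieldPoint π ((vanishingIdeal_transpose_le_ker_iff π i v hK hL).2 hZ) fun t => ?_
  obtain ⟨K', _, x, hxt, XK, kP, fK, H, hle⟩ := hcut t
  exact ⟨K', inferInstance, x, hxt, XK, kP, fK, H, by rwa [comap_vanishingIdeal_transpose H.w v hK hL]⟩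

/-- **The same with the fibre clause for ALL field points and ALL cartesian squares** (the quantifier shape of the cell's `hvan`/`hrank`
binders; the residue fields and Mathlib's chosen fibres suffice). [cite: Mumford1966CurvesSurface, Lecture 15 (IV.)–(V.) (pp. 107–108)]
[cite: GortzWedhorn2020, Prop. 4.20] -/
theorem ker_eq_vanishingIdeal_transpose_of_flat [IsLocallyNoetherian X] [Flat (i ≫ π)]
    (hK : IsAffineLocalizing K) (hL : IsFiniteLocallyFree L)
    (hZ : v ≫ (Scheme.Modules.pushforward π).map ((Scheme.Modules.pullbackPushforwardAdjunction i).unit.app L) = 0)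
    (hcut : ∀ ⦃K' : Type u⦄ [Field K'] ⦃XK : Scheme.{u}⦄ (kP : XK ⟶ X) (fK : XK ⟶ Spec (.of K')) (x : Spec (.of K') ⟶ T)
      (H : IsPullback kP fK π x), i.ker.comap kP ≤
        vanishingIdeal (((Scheme.Modules.pullbackPushforwardAdjunction fK).homEquiv _ _).symm
          ((Scheme.Modules.pullback x).map v ≫ pushforwardBaseChangeHom H.w L))) :
    i.ker = vanishingIdeal (((Scheme.Modules.pullbackPushforwardAdjunction π).homEquiv K L).symm v) :=
  ker_eq_vanishingIdeal_transpose_of_flat_of_fieldPoint π i v hK hL hZ fun t =>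
    ⟨_, inferInstance, T.fromSpecResidueField t, Scheme.fromSpecResidueField_apply _ _, π.fiber t, π.fiberι t,
      π.fiberToSpecResidueField t, IsPullback.of_hasPullback _ _,
      hcut (π.fiberι t) (π.fiberToSpecResidueField t) (T.fromSpecResidueField t) (IsPullback.of_hasPullback _ _)⟩

end Flat

end Literature.AlgebraicGeometry.Modules

end
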